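import Mathlib
import Literature.Computability.AlgebraicComplexity.StandardFamilies
import Summits.ValiantsHypothesis.ValiantsHypothesis.Theses.RefutationDegree

/-!
# Route `RefutationDegree` — the objects of the route (route-posited vocabulary, D-0016 `<RouteSlug>Defs.lean`)

Every statement item of route `RefutationDegree` (`Theses/RefutationDegree.lean`) inlines the same
`let`-expressions: the generic size-`m` affine pencil `A(x) = A₀ + Σ_e x_e A_e` in the `n²` variables
`x_e`, whose `(n²+1)m²` entries are the UNKNOWNS `a = (A₀, A_e)`; the DEFECT
`P = det A(x) − per_n(x)`, a polynomial in `x` whose coefficients `P.coeff μ = F_μ(a) − c_μ` are the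
EQUATIONS of the system Rep(n,m) ("per_n has a size-m affine determinantal expression"); the holomorphic
copy `eqn μ = rename Sum.inl (P.coeff μ)` in the doubled variables `(a, ā)`; the conjugation
`cj = (conjugate coefficients) ∘ (swap the two copies)`; and the two refutation formats —
Nullstellensatz (`HasNsRef n m D`: `Σ_μ h_μ · P.coeff μ = 1`, all products of total degree `≤ D`) and
Hermitian sums of squares (`HasSosRef n m D`: `Σ_i q_i·cj q_i + Σ_μ (h_μ·eqn_μ + cj(h_μ·eqn_μ)) + 1 = 0`,
all products of total degree `≤ D`).  This file names these objects ONCE, by transparent definitions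
that unfold (`Iff.rfl`, see the `*_iff` lemmas at the end) to the route's literal expressions, so that
the crux skeleton `Cruxes/RefutationBarrier/Lines/Sketch-ideator1.lean`, its stub files
`Theorems/RefutationDegreeRefutationBarrier*.lean` and the other items of the route speak about THE
SAME declarations.  It also names the two analytic notions of line `arc-contact-exponent`
(idea card `Cruxes/RefutationBarrier/Ideas/arc-contact-exponent.md`): affine border membership
`InBorder n m` and asymptotic pseudo-solutions of contact `D`, `ContactSeq n m D`.
Nothing here asserts anything; the only theorems are definitional unfoldings.

References: Mignon–Ressayre 2004 (the system Rep(n,m), affine model); Grigoriev 2001 and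
Buss–Impagliazzo–Krajíček–Pudlák–Razborov–Sgall 1997 (Positivstellensatz / Nullstellensatz refutation
degree); Landsberg–Manivel–Ressayre 2013 (border determinantal complexity).
-/

-- `Summit.ValiantsHypothesis.ValiantsHypothesis.…` is the tree's mandated single-conjunct layout
-- (Sub = Summit), so the duplicated namespace component is intended.
set_option linter.dupNamespace false

noncomputable section

namespace Summit.ValiantsHypothesis.ValiantsHypothesis.Theorems.RefutationDegree

open scoped BigOperators
open Filter Topology MvPolynomial
open Literature.Computability.AlgebraicComplexity (perPoly)
open Summit.ValiantsHypothesis.ValiantsHypothesis.Theses.RefutationDegree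

/-- The UNKNOWNS of Rep(n,m): an entry `(i,j)` of `A₀` (tag `none`) or of `A_e` (tag `some e`),
`(n²+1)m²` of them. [folklore] -/
abbrev Unk (n m : ℕ) : Type := Option (Fin n × Fin n) × (Fin m × Fin m)

/-- The generic size-`m` affine pencil `A(x) = A₀ + Σ_e x_e A_e` in the `n²` variables `x_e`: an
`m × m` matrix over `ℂ[a][x]` whose `x`-coefficients are the unknowns (literally the route's
`Matrix.of …`). [folklore] -/
def pencil (n m : ℕ) : Matrix (Fin m) (Fin m) (MvPolynomial (Fin n × Fin n) (MvPolynomial (Unk n m) ℂ)) :=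
  Matrix.of fun i j : Fin m => MvPolynomial.C (MvPolynomial.X (none, (i, j))) +
    ∑ e : Fin n × Fin n, MvPolynomial.X e * MvPolynomial.C (MvPolynomial.X (some e, (i, j)))

/-- The DEFECT `P = det A(x) − per_n(x) ∈ ℂ[a][x]` of Rep(n,m) (literally the route's `P`); its
`x`-coefficients `P.coeff μ = F_μ(a) − c_μ` are the equations of the system. [folklore] -/
def defect (n m : ℕ) : MvPolynomial (Fin n × Fin n) (MvPolynomial (Unk n m) ℂ) :=
  (pencil n m).det - MvPolynomial.map MvPolynomial.C (perPoly (Fin n) ℂ)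

/-- The holomorphic copy of the equation `P.coeff μ` in the doubled variables `(a, ā)` (literally the
route's `eqn`). [folklore] -/
def eqn (n m : ℕ) (μ : (Fin n × Fin n) →₀ ℕ) : MvPolynomial (Unk n m ⊕ Unk n m) ℂ :=
  MvPolynomial.rename Sum.inl ((defect n m).coeff μ)

/-- The CONJUGATION of the Hermitian-SOS format: conjugate the coefficients and swap the two copies of
the variables, `(cj p)(a, ā) = conj (p(a, ā))` at conjugate points (literally the route's `cj`).
[folklore] -/
def cj (σ : Type*) (p : MvPolynomial (σ ⊕ σ) ℂ) : MvPolynomial (σ ⊕ σ) ℂ :=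
  MvPolynomial.rename Sum.swap (MvPolynomial.map (starRingEnd ℂ) p)

/-- `HasNsRef n m D`: Rep(n,m) has a NULLSTELLENSATZ refutation `Σ_{μ ∈ supp P} h_μ · P.coeff μ = 1` in
which every product has total degree `≤ D` (the shape of the route's `BeyondHessianNs`,
`SmallCaseThreeFive`, `MrCalibration`, with general `m`, `D`; Buss et al. 1997).
[folklore] -/
def HasNsRef (n m D : ℕ) : Prop :=
  ∃ h : ((Fin n × Fin n) →₀ ℕ) → MvPolynomial (Unk n m) ℂ,
    (∀ μ, (h μ * (defect n m).coeff μ).totalDegree ≤ D) ∧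
      ∑ μ ∈ (defect n m).support, h μ * (defect n m).coeff μ = 1

/-- `HasSosRef n m D`: Rep(n,m) has a HERMITIAN-SOS (real Positivstellensatz) refutation
`Σ_i q_i·cj q_i + Σ_{μ ∈ supp P} (h_μ·eqn_μ + cj(h_μ·eqn_μ)) + 1 = 0` in `ℂ[a, ā]` in which every
product has total degree `≤ D` — the negated matrix of the route's crux `RefutationBarrier` with `n ^ c`
replaced by `D` (Grigoriev 2001). [folklore] -/
def HasSosRef (n m D : ℕ) : Prop :=
  ∃ (k : ℕ) (q : Fin k → MvPolynomial (Unk n m ⊕ Unk n m) ℂ)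
    (h : ((Fin n × Fin n) →₀ ℕ) → MvPolynomial (Unk n m ⊕ Unk n m) ℂ),
    (∀ i, (q i * cj (Unk n m) (q i)).totalDegree ≤ D) ∧
    (∀ μ, (h μ * eqn n m μ).totalDegree ≤ D) ∧
      ∑ i, q i * cj (Unk n m) (q i) +
        ∑ μ ∈ (defect n m).support, (h μ * eqn n m μ + cj (Unk n m) (h μ * eqn n m μ)) + 1 = 0

/-- AFFINE BORDER MEMBERSHIP at size `m`: `per_n` is a coefficientwise limit of determinants of size-`m`
affine pencils, i.e. every equation `P.coeff μ` tends to `0` along a sequence of genuine complex points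
`A_k` (line `arc-contact-exponent`; Landsberg–Manivel–Ressayre 2013 for the padded model). [folklore] -/
def InBorder (n m : ℕ) : Prop :=
  ∃ A : ℕ → (Unk n m → ℂ), ∀ μ,
    Tendsto (fun k => MvPolynomial.eval (A k) ((defect n m).coeff μ)) atTop (𝓝 0)

/-- ASYMPTOTIC PSEUDO-SOLUTIONS OF CONTACT `D`: genuine complex points `A_k` along which every equation
decays faster than `(1 + ‖A_k‖)^{-(D-m)}` (sup norm; natural-number subtraction intended: for `D ≤ m`
this is plain coefficientwise convergence).  An approximating Laurent arc of pole order `N` and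
precision `K` supplies this for every `D < m + K/N` (line `arc-contact-exponent`). [folklore] -/
def ContactSeq (n m D : ℕ) : Prop :=
  ∃ A : ℕ → (Unk n m → ℂ), ∀ μ,
    Tendsto (fun k => (1 + ‖A k‖) ^ (D - m) * ‖MvPolynomial.eval (A k) ((defect n m).coeff μ)‖)
      atTop (𝓝 0)

/-! ### The route's items in this vocabulary (definitional unfoldings, `Iff.rfl`) -/

/-- The crux `RefutationBarrier` is literally "`HasSosRef n m (n ^ c)` fails past the Hessian
bound, eventually in `n`". [folklore] -/
theorem refutationBarrier_iff :
    RefutationBarrier ↔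
      ∀ c : ℕ, ∃ n₀ : ℕ, ∀ n ≥ n₀, ∀ m : ℕ, n ^ 2 / 2 + 1 ≤ m → ¬ HasSosRef n m (n ^ c) :=
  Iff.rfl

/-- The crux `BeyondHessianNs` is literally an eventual `HasNsRef n (⌊n²/2⌋+1) (n ^ c)`. [folklore] -/
theorem beyondHessianNs_iff :
    BeyondHessianNs ↔ ∃ c n₀ : ℕ, ∀ n ≥ n₀, HasNsRef n (n ^ 2 / 2 + 1) (n ^ c) :=
  Iff.rfl

/-- The crux `BeyondHessianSos` is literally an eventual `HasSosRef n (⌊n²/2⌋+1) (n ^ c)`. [folklore] -/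
theorem beyondHessianSos_iff :
    BeyondHessianSos ↔ ∃ c n₀ : ℕ, ∀ n ≥ n₀, HasSosRef n (n ^ 2 / 2 + 1) (n ^ c) :=
  Iff.rfl

/-- The target `CertWindowQP` in this vocabulary. [folklore] -/
theorem certWindowQP_iff :
    CertWindowQP ↔
      ∃ c' : ℕ, ∀ c : ℕ, ∃ n : ℕ, ∀ m ≤ 2 ^ ((Nat.log 2 n + c) ^ c), HasSosRef n m ((m + 2) ^ c') :=
  Iff.rfl

/-- The crux `SmallCaseThreeFive` is literally `HasNsRef 3 5 55`. [folklore] -/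
theorem smallCaseThreeFive_iff : SmallCaseThreeFive ↔ HasNsRef 3 5 55 :=
  Iff.rfl

/-- The support item `NsToSos` is literally `HasNsRef n m d → HasSosRef n m d`. [folklore] -/
theorem nsToSos_iff : NsToSos ↔ ∀ n m d : ℕ, HasNsRef n m d → HasSosRef n m d :=
  Iff.rfl

/-- The support item `SosSound` is literally the soundness of `HasSosRef`. [folklore] -/
theorem sosSound_iff :
    SosSound ↔ ∀ n m d : ℕ, HasSosRef n m d →
      ¬ Literature.Computability.AlgebraicComplexity.HasDetRepr (perPoly (Fin n) ℂ) m :=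
  Iff.rfl

/-- The support item `MrCalibration` in this vocabulary. [folklore] -/
theorem mrCalibration_iff :
    MrCalibration ↔ ∃ c : ℕ, ∀ n m : ℕ, 3 ≤ n → 2 * m + 1 ≤ n ^ 2 → HasNsRef n m (c * (m + 1) ^ 2) :=
  Iff.rfl

end Summit.ValiantsHypothesis.ValiantsHypothesis.Theorems.RefutationDegree

end
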